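import Summits.CriticalPhenomena.PercolationContinuityZ3.Theorems.Transplant.FKDoubleFanWordCellsParts
import HarnessLib

/-!
# Double fans: the roof parts `R₀(w)`, `R₁(w)` as quadratics in the roof probe `w` with constant product vectors

Helper file (`--supports stmt-CriticalPhenomena-4575`), FK sub-lane `prim-bschramm-fk-3` (gen 49); builds on p205010 (kernel theorem, internal
audit signed; external expert review pending).  Pure real algebra, no sorries; standard axioms.  Memo `bschramm/prim-bschramm-fk-3/FAR-CROSS-XXIV.md` §3.

`roofR1 q w = C₀ + w·C₁ + w²·C₂` and `roofR0 q w = D₀ + w·D₁ + w²·D₂` with explicit product vectors whose entries are affine in `q`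
(**`roofR1_expand`**, **`roofR0_expand`**).  With the bilinearity of the polarized cells (`pcell2_add/smul_left/right`) this splits a roof–roof
polarized cell into nine cells at CONSTANT legs — the form in which the heaviest identities of the MIN campaign (`R₁` against `R₁` through the
words `T_D T_D T_D`, `T_D T_D I`) elaborate within the farm's time cap.
[folklore]
-/

noncomputable section

namespace Summit.CriticalPhenomena.PercolationContinuityZ3.Theorems

namespace FK

namespace ThreeApex

/-- **`R₁(w)` is quadratic in `w`**: `roofR1 q w = ⟨2−q, 2(2−q), 0, 2−q, 2−q, 0⟩ + w·⟨2, 0, 4−2q, 0, 4−2q, 2⟩ + w²·⟨−2, q−2, q−2, q−2, q−2, −2⟩`.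
[folklore] -/
theorem roofR1_expand (q w : ℝ) :
    roofR1 q w =
      P6.add (P6.add (⟨2 - q, 2 * (2 - q), 0, 2 - q, 2 - q, 0⟩ : P6) (P6.smul w ⟨2, 0, 4 - 2 * q, 0, 4 - 2 * q, 2⟩))
        (P6.smul (w ^ 2) ⟨-2, q - 2, q - 2, q - 2, q - 2, -2⟩) := by
  ext <;> simp only [roofR1, xwR, zwR, P6.add, P6.smul] <;> ring

/-- **`R₀(w)` is quadratic in `w`**: `roofR0 q w = ⟨0, 2−q, 0, 0, 0, 0⟩ + w·⟨2, 0, 0, 0, 4−2q, 0⟩ + w²·⟨−2, q−2, 0, 0, q−2, 0⟩`. [folklore] -/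
theorem roofR0_expand (q w : ℝ) :
    roofR0 q w =
      P6.add (P6.add (⟨0, 2 - q, 0, 0, 0, 0⟩ : P6) (P6.smul w ⟨2, 0, 0, 0, 4 - 2 * q, 0⟩))
        (P6.smul (w ^ 2) ⟨-2, q - 2, 0, 0, q - 2, 0⟩) := by
  ext <;> simp only [roofR0, xwR, zwR, P6.add, P6.smul] <;> ring

end ThreeApex

end FK

end Summit.CriticalPhenomena.PercolationContinuityZ3.Theorems
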